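import Summits.KontsevichZagierPeriods.KontsevichZagierPeriods.Theses.SymplecticScissors

/-!
# Signed sweep of the triangle, helper II: one-variable analysis

Helper file for the stub `stub_signedSweep` of the line `twist-restoring-shear` (crux
`PlanarCompiler`, route `SymplecticScissors`). Elementary real analysis used by the sweep:

* extension of a bounded monotone (or antitone, or constant) continuous function from an open
  interval to the closed interval by its one-sided limits (`extendFrom`), keeping continuity and
  monotonicity;
* injectivity of a sheared coordinate projection `p ↦ (p_j, F p)` on a set whose coordinate
  slices are segments when `∂_i F` has a constant sign (mean value theorem), and the slice
  property for the cells `{a ∈ (u, v), lo a < b < hi a}` of the sweep.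
-/

noncomputable section

open MeasureTheory Set Filter Topology
open Literature.NumberTheory.Transcendental Literature.ModelTheory.ExponentialFields

namespace Summit.KontsevichZagierPeriods.SymplecticScissors.PlanarCompilerProof

/-! ### Extension to the closed interval -/

/-- A bounded monotone continuous function on `(u, v)` extends by its one-sided limits to a
continuous monotone function on `[u, v]`. [folklore] -/
theorem extendFrom_Ioo_of_monotoneOn {f : ℝ → ℝ} {u v : ℝ} (huv : u < v)
    (hc : ContinuousOn f (Ioo u v)) (hm : MonotoneOn f (Ioo u v)) (hb : BddBelow (f '' Ioo u v))
    (ha : BddAbove (f '' Ioo u v)) :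
    ContinuousOn (extendFrom (Ioo u v) f) (Icc u v) ∧ MonotoneOn (extendFrom (Ioo u v) f) (Icc u v) := by
  have hne : (Ioo u v).Nonempty := nonempty_Ioo.2 huv
  have hu : Tendsto f (𝓝[>] u) (𝓝 (sInf (f '' Ioo u v))) := hm.tendsto_nhdsWithin_Ioo_right hne hb
  have hv : Tendsto f (𝓝[<] v) (𝓝 (sSup (f '' Ioo u v))) := hm.tendsto_nhdsWithin_Ioo_left hne ha
  have hgu : extendFrom (Ioo u v) f u = sInf (f '' Ioo u v) := eq_lim_at_left_extendFrom_Ioo huv hu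
  have hgv : extendFrom (Ioo u v) f v = sSup (f '' Ioo u v) := eq_lim_at_right_extendFrom_Ioo huv hv
  have hg : ∀ t ∈ Ioo u v, extendFrom (Ioo u v) f t = f t := extendFrom_extends hc
  have hlo : ∀ t ∈ Ioo u v, sInf (f '' Ioo u v) ≤ f t := fun t ht => csInf_le hb (mem_image_of_mem f ht)
  have hhi : ∀ t ∈ Ioo u v, f t ≤ sSup (f '' Ioo u v) := fun t ht => le_csSup ha (mem_image_of_mem f ht)
  refine ⟨continuousOn_Icc_extendFrom_Ioo hc hu hv, ?_⟩
  intro a ha' b hb' hab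
  obtain ⟨m, hm'⟩ := hne
  rcases eq_endpoints_or_mem_Ioo_of_mem_Icc ha' with rfl | rfl | haI
  · rcases eq_endpoints_or_mem_Ioo_of_mem_Icc hb' with rfl | rfl | hbI
    · exact le_rfl
    · rw [hgu, hgv]; exact (hlo m hm').trans (hhi m hm')
    · rw [hgu, hg b hbI]; exact hlo b hbI
  · have : b = a := le_antisymm hb'.2 hab
    rw [this]
  · rcases eq_endpoints_or_mem_Ioo_of_mem_Icc hb' with rfl | rfl | hbI
    · exact absurd hab (not_le.2 haI.1)
    · rw [hgv, hg a haI]; exact hhi a haI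
    · rw [hg a haI, hg b hbI]; exact hm haI hbI hab

/-- A bounded antitone continuous function on `(u, v)` extends by its one-sided limits to a
continuous antitone function on `[u, v]`. [folklore] -/
theorem extendFrom_Ioo_of_antitoneOn {f : ℝ → ℝ} {u v : ℝ} (huv : u < v)
    (hc : ContinuousOn f (Ioo u v)) (hm : AntitoneOn f (Ioo u v)) (hb : BddBelow (f '' Ioo u v))
    (ha : BddAbove (f '' Ioo u v)) :
    ContinuousOn (extendFrom (Ioo u v) f) (Icc u v) ∧ AntitoneOn (extendFrom (Ioo u v) f) (Icc u v) := by
  have hne : (Ioo u v).Nonempty := nonempty_Ioo.2 huv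
  have hu : Tendsto f (𝓝[>] u) (𝓝 (sSup (f '' Ioo u v))) := hm.tendsto_nhdsWithin_Ioo_right hne ha
  have hv : Tendsto f (𝓝[<] v) (𝓝 (sInf (f '' Ioo u v))) := hm.tendsto_nhdsWithin_Ioo_left hne hb
  have hgu : extendFrom (Ioo u v) f u = sSup (f '' Ioo u v) := eq_lim_at_left_extendFrom_Ioo huv hu
  have hgv : extendFrom (Ioo u v) f v = sInf (f '' Ioo u v) := eq_lim_at_right_extendFrom_Ioo huv hv
  have hg : ∀ t ∈ Ioo u v, extendFrom (Ioo u v) f t = f t := extendFrom_extends hc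
  have hlo : ∀ t ∈ Ioo u v, sInf (f '' Ioo u v) ≤ f t := fun t ht => csInf_le hb (mem_image_of_mem f ht)
  have hhi : ∀ t ∈ Ioo u v, f t ≤ sSup (f '' Ioo u v) := fun t ht => le_csSup ha (mem_image_of_mem f ht)
  refine ⟨continuousOn_Icc_extendFrom_Ioo hc hu hv, ?_⟩
  intro a ha' b hb' hab
  obtain ⟨m, hm'⟩ := hne
  rcases eq_endpoints_or_mem_Ioo_of_mem_Icc ha' with rfl | rfl | haI
  · rcases eq_endpoints_or_mem_Ioo_of_mem_Icc hb' with rfl | rfl | hbI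
    · exact le_rfl
    · rw [hgu, hgv]; exact (hlo m hm').trans (hhi m hm')
    · rw [hgu, hg b hbI]; exact hhi b hbI
  · have : b = a := le_antisymm hb'.2 hab
    rw [this]
  · rcases eq_endpoints_or_mem_Ioo_of_mem_Icc hb' with rfl | rfl | hbI
    · exact absurd hab (not_le.2 haI.1)
    · rw [hgv, hg a haI]; exact hlo a haI
    · rw [hg a haI, hg b hbI]; exact hm haI hbI hab

/-- **Extension of a section to the closed strip.** A continuous function on `(u, v)` which is
constant, strictly increasing or strictly decreasing, with values in `[m, M]`, extends (by
`extendFrom`, i.e. by its one-sided limits) to a continuous function on `[u, v]` which is monotone or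
antitone there and agrees with the given one on `(u, v)`. [folklore] -/
theorem extendFrom_Ioo_spec {f : ℝ → ℝ} {u v m M : ℝ} (huv : u < v) (hc : ContinuousOn f (Ioo u v))
    (hshape : (∃ c, EqOn f (fun _ => c) (Ioo u v)) ∨ StrictMonoOn f (Ioo u v) ∨ StrictAntiOn f (Ioo u v))
    (hbd : ∀ t ∈ Ioo u v, m ≤ f t ∧ f t ≤ M) :
    ContinuousOn (extendFrom (Ioo u v) f) (Icc u v) ∧
      (MonotoneOn (extendFrom (Ioo u v) f) (Icc u v) ∨ AntitoneOn (extendFrom (Ioo u v) f) (Icc u v)) ∧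
      EqOn (extendFrom (Ioo u v) f) f (Ioo u v) := by
  have hb : BddBelow (f '' Ioo u v) := ⟨m, by rintro _ ⟨t, ht, rfl⟩; exact (hbd t ht).1⟩
  have ha : BddAbove (f '' Ioo u v) := ⟨M, by rintro _ ⟨t, ht, rfl⟩; exact (hbd t ht).2⟩
  have heq : EqOn (extendFrom (Ioo u v) f) f (Ioo u v) := extendFrom_extends hc
  rcases hshape with ⟨c, hcst⟩ | hmono | hanti
  · have hm : MonotoneOn f (Ioo u v) := fun a ha' b hb' _ => by rw [hcst ha', hcst hb']
    obtain ⟨h1, h2⟩ := extendFrom_Ioo_of_monotoneOn huv hc hm hb ha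
    exact ⟨h1, Or.inl h2, heq⟩
  · obtain ⟨h1, h2⟩ := extendFrom_Ioo_of_monotoneOn huv hc hmono.monotoneOn hb ha
    exact ⟨h1, Or.inl h2, heq⟩
  · obtain ⟨h1, h2⟩ := extendFrom_Ioo_of_antitoneOn huv hc hanti.antitoneOn hb ha
    exact ⟨h1, Or.inr h2, heq⟩

/-- The extension of a function agreeing on `(u, v)` with a continuous `g : ℝ → ℝ` is `g` on all of
`[u, v]`. [folklore] -/
theorem extendFrom_Ioo_eq_of_eqOn {f g : ℝ → ℝ} {u v : ℝ} (huv : u < v) (hfg : EqOn f g (Ioo u v))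
    (hg : Continuous g) : ∀ t ∈ Icc u v, extendFrom (Ioo u v) f t = g t := by
  intro t ht
  refine extendFrom_eq (by rw [closure_Ioo huv.ne]; exact ht) ?_
  have h1 : Tendsto g (𝓝[Ioo u v] t) (𝓝 (g t)) := (hg.tendsto t).mono_left nhdsWithin_le_nhds
  exact h1.congr' hfg.eventuallyEq_nhdsWithin.symm

/-- `extendFrom` only depends on the values on the set. [folklore] -/
theorem extendFrom_Ioo_congr {f g : ℝ → ℝ} {u v : ℝ} (hfg : EqOn f g (Ioo u v)) :
    extendFrom (Ioo u v) f = extendFrom (Ioo u v) g := by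
  funext t
  simp only [extendFrom, limUnder]
  have : Filter.map f (𝓝[Ioo u v] t) = Filter.map g (𝓝[Ioo u v] t) :=
    Filter.map_congr hfg.eventuallyEq_nhdsWithin
  rw [this]

/-! ### Injectivity of the sheared projections -/

/-- **Mean value injectivity.** On an open set `C` on which `F` is differentiable with
`ε ∂_i F > 0`, if the coordinate segment between two points of `C` differing only in the `i`-th
coordinate stays in `C`, then `F` separates such points. [folklore] -/
theorem eq_of_fderiv_sign {i : Fin 2} {F : (Fin 2 → ℝ) → ℝ} {C : Set (Fin 2 → ℝ)} {ε : ℝ}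
    (hC : IsOpen C) (hF : DifferentiableOn ℝ F C)
    (hpos : ∀ p ∈ C, 0 < ε * fderiv ℝ F p (Pi.single i 1))
    (hconn : ∀ p ∈ C, ∀ q ∈ C, (∀ j, j ≠ i → p j = q j) → p i ≤ q i →
      ∀ s ∈ Icc (p i) (q i), Function.update p i s ∈ C) :
    ∀ p ∈ C, ∀ q ∈ C, (∀ j, j ≠ i → p j = q j) → F p = F q → p = q := by
  have key : ∀ p ∈ C, ∀ q ∈ C, (∀ j, j ≠ i → p j = q j) → F p = F q → ¬ p i < q i := by
    intro p hp q hq hpq hFpq hlt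
    set γ : ℝ → Fin 2 → ℝ := Function.update p i with hγ
    have hγp : γ (p i) = p := by simp [hγ]
    have hγq : γ (q i) = q := by
      ext j
      by_cases hj : j = i
      · subst hj; simp [hγ]
      · simp [hγ, hj, hpq j hj]
    have hmem : ∀ s ∈ Icc (p i) (q i), γ s ∈ C := hconn p hp q hq hpq hlt.le
    have hder : ∀ s ∈ Icc (p i) (q i),
        HasDerivAt (F ∘ γ) (fderiv ℝ F (γ s) (Pi.single i 1)) s := by
      intro s hs
      have hd : DifferentiableAt ℝ F (γ s) := hF.differentiableAt (hC.mem_nhds (hmem s hs))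
      exact hd.hasFDerivAt.comp_hasDerivAt s (hasDerivAt_update p i s)
    have hcont : ContinuousOn (F ∘ γ) (Icc (p i) (q i)) :=
      fun s hs => (hder s hs).continuousAt.continuousWithinAt
    obtain ⟨c, hc, hslope⟩ := exists_hasDerivAt_eq_slope (F ∘ γ)
      (fun s => fderiv ℝ F (γ s) (Pi.single i 1)) hlt hcont
      (fun s hs => hder s (Ioo_subset_Icc_self hs))
    have h0 : fderiv ℝ F (γ c) (Pi.single i 1) = 0 := by
      rw [hslope]
      simp [Function.comp, hγp, hγq, hFpq]
    have := hpos (γ c) (hmem c (Ioo_subset_Icc_self hc))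
    rw [h0, mul_zero] at this
    exact lt_irrefl _ this
  intro p hp q hq hpq hFpq
  rcases lt_trichotomy (p i) (q i) with hlt | heq | hgt
  · exact absurd hlt (key p hp q hq hpq hFpq)
  · ext j
    by_cases hj : j = i
    · subst hj; exact heq
    · exact hpq j hj
  · exact absurd hgt (key q hq p hp (fun j hj => (hpq j hj).symm) hFpq.symm)

/-- Injectivity of the vertical shear `p ↦ (p 0, F p)` from a sign of `∂_1 F` and vertical
convexity. [folklore] -/
theorem stub_signedSweep_injOnShear :
    ∀ {F : (Fin 2 → ℝ) → ℝ} {C : Set (Fin 2 → ℝ)} {ε : ℝ}, IsOpen C → DifferentiableOn ℝ F C →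
    (∀ p ∈ C, 0 < ε * fderiv ℝ F p (Pi.single 1 1)) →
    (∀ p ∈ C, ∀ q ∈ C, p 0 = q 0 → p 1 ≤ q 1 → ∀ s ∈ Icc (p 1) (q 1), Function.update p 1 s ∈ C) →
    InjOn (fun p : Fin 2 → ℝ => (![p 0, F p] : Fin 2 → ℝ)) C := by
  intro F C ε hC hF hpos hconn p hp q hq hpq
  have h0 : p 0 = q 0 := by
    have := congrFun hpq 0
    simpa using this
  have h1 : F p = F q := by
    have := congrFun hpq 1
    simpa using this
  refine eq_of_fderiv_sign (i := 1) hC hF hpos (fun p hp q hq hpq' hle => hconn p hp q hq ?_ hle)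
    p hp q hq (fun j hj => ?_) h1
  · exact hpq' 0 (by decide)
  · have : j = 0 := by omega
    subst this; exact h0

/-- Injectivity of the horizontal shear `p ↦ (p 1, F p)` from a sign of `∂_0 F` and horizontal
convexity. [folklore] -/
theorem injOn_shear_snd {F : (Fin 2 → ℝ) → ℝ} {C : Set (Fin 2 → ℝ)} {ε : ℝ}
    (hC : IsOpen C) (hF : DifferentiableOn ℝ F C)
    (hpos : ∀ p ∈ C, 0 < ε * fderiv ℝ F p (Pi.single 0 1))
    (hconn : ∀ p ∈ C, ∀ q ∈ C, p 1 = q 1 → p 0 ≤ q 0 →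
      ∀ s ∈ Icc (p 0) (q 0), Function.update p 0 s ∈ C) :
    InjOn (fun p : Fin 2 → ℝ => (![p 1, F p] : Fin 2 → ℝ)) C := by
  intro p hp q hq hpq
  have h0 : p 1 = q 1 := by
    have := congrFun hpq 0
    simpa using this
  have h1 : F p = F q := by
    have := congrFun hpq 1
    simpa using this
  refine eq_of_fderiv_sign (i := 0) hC hF hpos (fun p hp q hq hpq' hle => hconn p hp q hq ?_ hle)
    p hp q hq (fun j hj => ?_) h1
  · exact hpq' 1 (by decide)
  · have : j = 1 := by omega
    subst this; exact h0

/-- Vertical slices of a cell `{a ∈ (u, v), lo a < b < hi a}` are segments. [folklore] -/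
theorem cell_update_one_mem {lo hi : ℝ → ℝ} {u v : ℝ} :
    ∀ p ∈ {p : Fin 2 → ℝ | p 0 ∈ Ioo u v ∧ lo (p 0) < p 1 ∧ p 1 < hi (p 0)},
      ∀ q ∈ {p : Fin 2 → ℝ | p 0 ∈ Ioo u v ∧ lo (p 0) < p 1 ∧ p 1 < hi (p 0)},
        p 0 = q 0 → p 1 ≤ q 1 → ∀ s ∈ Icc (p 1) (q 1),
          Function.update p 1 s ∈ {p : Fin 2 → ℝ | p 0 ∈ Ioo u v ∧ lo (p 0) < p 1 ∧ p 1 < hi (p 0)} := by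
  intro p hp q hq h0 _ s hs
  have e0 : Function.update p 1 s 0 = p 0 := Function.update_of_ne (by decide) _ _
  have e1 : Function.update p 1 s 1 = s := Function.update_self _ _ _
  simp only [mem_setOf_eq] at hp hq ⊢
  rw [e0, e1]
  refine ⟨hp.1, hp.2.1.trans_le hs.1, hs.2.trans_lt ?_⟩
  rw [h0]; exact hq.2.2

/-- Horizontal slices of a cell `{a ∈ (u, v), lo a < b < hi a}` with `lo`, `hi` each monotone or
antitone on `[u, v]` are segments. [folklore] -/
theorem cell_update_zero_mem {lo hi : ℝ → ℝ} {u v : ℝ}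
    (hlo : MonotoneOn lo (Icc u v) ∨ AntitoneOn lo (Icc u v))
    (hhi : MonotoneOn hi (Icc u v) ∨ AntitoneOn hi (Icc u v)) :
    ∀ p ∈ {p : Fin 2 → ℝ | p 0 ∈ Ioo u v ∧ lo (p 0) < p 1 ∧ p 1 < hi (p 0)},
      ∀ q ∈ {p : Fin 2 → ℝ | p 0 ∈ Ioo u v ∧ lo (p 0) < p 1 ∧ p 1 < hi (p 0)},
        p 1 = q 1 → p 0 ≤ q 0 → ∀ s ∈ Icc (p 0) (q 0),
          Function.update p 0 s ∈ {p : Fin 2 → ℝ | p 0 ∈ Ioo u v ∧ lo (p 0) < p 1 ∧ p 1 < hi (p 0)} := by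
  intro p hp q hq h1 _ s hs
  have e0 : Function.update p 0 s 0 = s := Function.update_self _ _ _
  have e1 : Function.update p 0 s 1 = p 1 := Function.update_of_ne (by decide) _ _
  simp only [mem_setOf_eq] at hp hq ⊢
  rw [e0, e1]
  have hsI : s ∈ Ioo u v := ⟨hp.1.1.trans_le hs.1, hs.2.trans_lt hq.1.2⟩
  have hpI : p 0 ∈ Icc u v := Ioo_subset_Icc_self hp.1
  have hqI : q 0 ∈ Icc u v := Ioo_subset_Icc_self hq.1
  have hsI' : s ∈ Icc u v := Ioo_subset_Icc_self hsI
  refine ⟨hsI, ?_, ?_⟩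
  · rcases hlo with hlo | hlo
    · calc lo s ≤ lo (q 0) := hlo hsI' hqI hs.2
        _ < q 1 := hq.2.1
        _ = p 1 := h1.symm
    · exact (hlo hpI hsI' hs.1).trans_lt hp.2.1
  · rcases hhi with hhi | hhi
    · exact hp.2.2.trans_le (hhi hpI hsI' hs.1)
    · calc p 1 = q 1 := h1
        _ < hi (q 0) := hq.2.2
        _ ≤ hi s := hhi hsI' hqI hs.2

end Summit.KontsevichZagierPeriods.SymplecticScissors.PlanarCompilerProof
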